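import Mathlib
import HarnessLib
import Summits.HubbardSuperconductivity.HubbardSuperconductivity.Theorems.KLProgrammeKLRegimeTwoVolumeSourceReadout

/-!
# Route `KLProgramme` — crux K3, VL child `KLRegimeVolumeLimitV17F2` (stmt-HubbardSuperconductivity-20440): the END read-out for the FAMILY-DECOUPLED
# carriers `klSrcActionAt … J n` / `klSrcPinnedSumAt … J r n` of token #24 (k3c4-p1 g12's Defs append, pen (R75f) «(VL)-SUBDIAG-READOUT»)
# (cell gate-hubbard-kl, seat hubbard-kl-k3c5-p3 g13, technique «OS-positivity-free direct assembly»; `--supports` stmt-…-20440)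

The (vi) spine analyses the ALIVE legs of `𝒱⁽ⁿ⁾` with the family one level coarser (`J = n − 1`), and skeleton v10's producer stub will read
`SourceProfilesAtLev … J r n` instead of v9's diagonal `SourceProfilesAt … n` (`J = r = n`).  The END of 20440 reads only SOURCE legs (copy `1`, sector slot
`0`), whose rows in `klSrcAnalysisAt … J` are the PLAIN analysis `E_plain` for every `J`.  This file is the `J`/`r`-decoupled twin of
`…TwoVolumeSourceReadout` §1–§2b and the ONE comparison the v10 re-key of the END wrappers needs:

* §1 rows of `klSrcAnalysisAt` (`_apply_alive/_src/_dead`); §2 kernels of `klSrcActionAt … J n` by copy: **`kernel_klSrcActionAt_src`** (all-source slot-`0`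
  strings read the plain position kernels of `𝒱⁽ⁿ⁾` — `J`-FREE), `kernel_klSrcActionAt_alive` (the `F_J`-sectorised kernels of `𝒱⁽ⁿ⁾` = M3b's `hNV` object),
  `kernel_klSrcActionAt_eq_zero_of_dead`, the pair dictionary `kernel(_srcTrunc)_klSrcActionAt_pair`, and **`kernel_klSrcActionAt_pair_eq_klSrcAction_pair`**
  (the `(+,−)` source-pair kernels do not see `J`);
* §3 **`klSrcPinnedSum_two_two_le_klSrcPinnedSumAt`**: for `r ≤ n` and every `J`, the v9 END datum `klSrcPinnedSum … n 2 2 0 ((o,(0,a,σ)),1)` is at most the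
  v10 datum `klSrcPinnedSumAt … J r n 2 2 0 ((o,(0,a,σ)),1)` (dead second legs contribute `0`; slot-`0` strings relabel injectively into `SrcLabel … J` with the
  same positions — `srcLegPos` ignores the sector label — the same kernels, and the tree weight only grows as the rate index decreases,
  `Λ_n ≤ Λ_r`); **`klSrcPinnedSum_two_two_le_of_sourceProfilesAtLev`**: under `SourceProfilesAtLev L M (klSrcBudget P Q U A j) β U μ K J r n` (`r ≤ n`) every
  v9 END datum is `≤ A j 2` — so the doors (h)/(j)/(j′) and the stub wrappers re-key to v10 by ONE `le_trans`.

Proofs only; no definition.  References: BGM 2006 §2.7 (2.70)–(2.71), §2.9 (4.3)–(4.6).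
-/

noncomputable section

namespace Summit.HubbardSuperconductivity.HubbardSuperconductivity.Theorems.TwoVolumeSource

set_option linter.dupNamespace false -- summit = problem name (single-conjunct summit), D-0017

open Finset Literature.MathematicalPhysics.QuantumLattice Literature.Probability.LatticeModels GrassmannAlgebra
open Summit.HubbardSuperconductivity.HubbardSuperconductivity.Theorems.KLProgrammeLegKernels
open Summit.HubbardSuperconductivity.HubbardSuperconductivity.Theorems.KLRegimeSplit
open Summit.HubbardSuperconductivity.HubbardSuperconductivity.Theorems.TwoVolumeDefect
open Summit.HubbardSuperconductivity.HubbardSuperconductivity.Theorems.EngineV8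

/-! ## §1 The rows of the family-decoupled doubled analysis matrix -/

section RowsAt

variable {L M : ℕ}

/-- Copy `0` rows: the sector analysis of the alive family `F_J`. [cite: BenfattoGiulianiMastropietro2006, §2.7 (2.70)] -/
theorem klSrcAnalysisAt_apply_alive (β μ : ℝ) (K : TrigPolyC4v) (J : ℕ) (Y : SrcLabel L M J) (hY : Y.2 = 0) :
    klSrcAnalysisAt L M β μ K J Y = sectorAnalysisMatrix L M β (klAnisoFamily L M β μ K klE0 J) Y.1 := by
  ext X
  rw [klSrcAnalysisAt, Matrix.of_apply, if_pos hY]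

/-- Copy `1` rows in sector slot `0`: the PLAIN analysis at the relabelled plain label — the same for every `J`. [cite: BenfattoGiulianiMastropietro2006, §2.9 (4.3)-(4.6)] -/
theorem klSrcAnalysisAt_apply_src (β μ : ℝ) (K : TrigPolyC4v) (J : ℕ) (Y : SrcLabel L M J) (hY : Y.2 = 1) (h0 : (Y.1.2.1.1 : ℕ) = 0) :
    klSrcAnalysisAt L M β μ K J Y = sectorAnalysisMatrix L M β (trivialMultiplier L M) (Y.1.1, (((0 : Fin 1), Y.1.2.1.2), Y.1.2.2)) := by
  ext X
  rw [klSrcAnalysisAt, Matrix.of_apply, if_neg (by rw [hY]; decide), if_pos h0]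

/-- Copy `1` rows outside sector slot `0` are dead. [folklore] -/
theorem klSrcAnalysisAt_apply_dead (β μ : ℝ) (K : TrigPolyC4v) (J : ℕ) (Y : SrcLabel L M J) (hY : Y.2 = 1) (h0 : (Y.1.2.1.1 : ℕ) ≠ 0) :
    klSrcAnalysisAt L M β μ K J Y = 0 := by
  ext X
  rw [klSrcAnalysisAt, Matrix.of_apply, if_neg (by rw [hY]; decide), if_neg h0, Pi.zero_apply]

end RowsAt

/-! ## §2 Kernels of `klSrcActionAt … J n` by copy -/

section KernelsAt

variable {L M : ℕ} [NeZero L]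

/-- **All-source slot-`0` strings read the plain position-space kernels of `𝒱⁽ⁿ⁾` — independently of the alive family `F_J`.**
[cite: BenfattoGiulianiMastropietro2006, §2.9 (4.3)-(4.6)] -/
theorem kernel_klSrcActionAt_src (β U μ : ℝ) (K : TrigPolyC4v) (J n m : ℕ) (X : Fin m → SrcLabel L M J)
    (hX : ∀ i, (X i).2 = 1) (h0 : ∀ i, ((X i).1.2.1.1 : ℕ) = 0) :
    kernel ℂ (klSrcActionAt L M β U μ K J n) m X =
      sectorisedKernel L M β (trivialMultiplier L M) (klEffectiveAction L M β U μ K klE0 n) m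
        (fun i => ((((0 : Fin 1), (X i).1.2.1.2), (X i).1.2.2) : SectorLeg 1)) (fun i => (X i).1.1) := by
  rw [klSrcActionAt, kernel_map_toLin'_eq_of_rows_eq (klSrcAnalysisAt L M β μ K J) (sectorAnalysisMatrix L M β (trivialMultiplier L M)) _ m X
      (fun i => ((X i).1.1, (((0 : Fin 1), (X i).1.2.1.2), (X i).1.2.2))) fun i => klSrcAnalysisAt_apply_src β μ K J (X i) (hX i) (h0 i),
    kernel_map_sectorAnalysis]

/-- **All-alive strings read the `F_J`-sectorised kernels of `𝒱⁽ⁿ⁾`** (the object of M3b's sub-diagonal one-volume profile `hNV`).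
[cite: BenfattoGiulianiMastropietro2006, §2.7 (2.70)] -/
theorem kernel_klSrcActionAt_alive (β U μ : ℝ) (K : TrigPolyC4v) (J n m : ℕ) (X : Fin m → SrcLabel L M J) (hX : ∀ i, (X i).2 = 0) :
    kernel ℂ (klSrcActionAt L M β U μ K J n) m X =
      sectorisedKernel L M β (klAnisoFamily L M β μ K klE0 J) (klEffectiveAction L M β U μ K klE0 n) m
        (fun i => (X i).1.2) (fun i => (X i).1.1) := by
  rw [klSrcActionAt, kernel_map_toLin'_eq_of_rows_eq (klSrcAnalysisAt L M β μ K J)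
      (sectorAnalysisMatrix L M β (klAnisoFamily L M β μ K klE0 J)) _ m X (fun i => (X i).1) fun i => klSrcAnalysisAt_apply_alive β μ K J (X i) (hX i),
    kernel_map_sectorAnalysis]

/-- A copy-`1` leg outside sector slot `0` kills the string. [folklore] -/
theorem kernel_klSrcActionAt_eq_zero_of_dead (β U μ : ℝ) (K : TrigPolyC4v) (J n m : ℕ) (X : Fin m → SrcLabel L M J) {i : Fin m}
    (hX : (X i).2 = 1) (h0 : ((X i).1.2.1.1 : ℕ) ≠ 0) :
    kernel ℂ (klSrcActionAt L M β U μ K J n) m X = 0 := by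
  rw [klSrcActionAt]
  exact kernel_map_toLin'_eq_zero_of_row_eq_zero _ _ m X (i := i) (klSrcAnalysisAt_apply_dead β μ K J (X i) hX h0)

/-- The `(+,−)` source pair at `(x, y)`, spin `↑`, sector slot `0`, read through `srcTrunc 3`, is the plain two-leg kernel of `𝒱⁽ⁿ⁾` — for every `J`.
[cite: BenfattoGiulianiMastropietro2006, §2.9 (4.3)-(4.6)] -/
theorem kernel_srcTrunc_klSrcActionAt_pair (β U μ : ℝ) (K : TrigPolyC4v) (J n : ℕ) (x y : SpaceTimeIdx L M) :
    kernel ℂ (srcTrunc ℂ (fun Y : SrcLabel L M J => Y.2 = 1) 3 (klSrcActionAt L M β U μ K J n)) 2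
        ![((x, ((⟨0, sectorCount_pos J⟩, 0), 0)), 1), ((y, ((⟨0, sectorCount_pos J⟩, 0), 1)), 1)] =
      sectorisedKernel L M β (trivialMultiplier L M) (klEffectiveAction L M β U μ K klE0 n) 2
        (![((0, 0), 0), ((0, 0), 1)] : Fin 2 → SectorLeg 1) ![x, y] := by
  rw [kernel_srcTrunc_three_two, kernel_klSrcActionAt_src β U μ K J n 2 _ (fun i => by fin_cases i <;> rfl) (fun i => by fin_cases i <;> rfl)]
  congr 1 <;> funext i <;> fin_cases i <;> rfl

/-- The pair dictionary, untruncated form. [cite: BenfattoGiulianiMastropietro2006, §2.9 (4.3)-(4.6)] -/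
theorem kernel_klSrcActionAt_pair (β U μ : ℝ) (K : TrigPolyC4v) (J n : ℕ) (x y : SpaceTimeIdx L M) :
    kernel ℂ (klSrcActionAt L M β U μ K J n) 2 ![((x, ((⟨0, sectorCount_pos J⟩, 0), 0)), 1), ((y, ((⟨0, sectorCount_pos J⟩, 0), 1)), 1)] =
      sectorisedKernel L M β (trivialMultiplier L M) (klEffectiveAction L M β U μ K klE0 n) 2
        (![((0, 0), 0), ((0, 0), 1)] : Fin 2 → SectorLeg 1) ![x, y] := by
  rw [← kernel_srcTrunc_three_two, kernel_srcTrunc_klSrcActionAt_pair]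

/-- **The `(+,−)` source-pair kernels do not see the alive family**: `klSrcActionAt … J n` and `klSrcAction … n` have the same pair kernels.
[cite: BenfattoGiulianiMastropietro2006, §2.9 (4.3)-(4.6)] -/
theorem kernel_klSrcActionAt_pair_eq_klSrcAction_pair (β U μ : ℝ) (K : TrigPolyC4v) (J n : ℕ) (x y : SpaceTimeIdx L M) :
    kernel ℂ (klSrcActionAt L M β U μ K J n) 2 ![((x, ((⟨0, sectorCount_pos J⟩, 0), 0)), 1), ((y, ((⟨0, sectorCount_pos J⟩, 0), 1)), 1)] =
      kernel ℂ (klSrcAction L M β U μ K n) 2 ![((x, ((⟨0, sectorCount_pos n⟩, 0), 0)), 1), ((y, ((⟨0, sectorCount_pos n⟩, 0), 1)), 1)] := by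
  rw [kernel_klSrcActionAt_pair, kernel_klSrcAction_pair]

end KernelsAt

/-! ## §3 The v9 END datum is dominated by the v10 datum: `klSrcPinnedSum … n 2 2 ≤ klSrcPinnedSumAt … J r n 2 2` (`r ≤ n`) -/

section Compare

variable {L M : ℕ} [NeZero L]

omit [NeZero L] in
/-- A degree-`2` string with source count `2` has both legs on copy `1`. [folklore] -/
theorem copy_eq_one_of_srcCount_two {N : ℕ} (X : Fin 2 → SrcLabel L M N) (h : srcCount (fun Y : SrcLabel L M N => Y.2 = 1) X = 2) (i : Fin 2) :
    (X i).2 = 1 := by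
  have hc : (univ.filter fun j : Fin 2 => (X j).2 = 1).card = (univ : Finset (Fin 2)).card := by
    rw [card_univ, Fintype.card_fin]; exact h
  exact (Finset.card_filter_eq_iff.1 hc) i (mem_univ i)

omit [NeZero L] in
/-- The slot-`0` relabelling of a string of `SrcLabel … N` legs into `SrcLabel … J` (space-time index, `±` index, spin and copy kept; sector index `0`).
[folklore] -/
theorem srcLegPos_slotZero_relabel {N J : ℕ} (hJ : 0 < sectorCount J) (Y : SrcLabel L M N) :
    srcLegPos L M (2 * (2 * M)) ((((Y.1.1, ((⟨0, hJ⟩, Y.1.2.1.2), Y.1.2.2)), Y.2) : SrcLabel L M J)) = srcLegPos L M (2 * (2 * M)) Y := rfl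

/-- **`klSrcPinnedSum … n 2 2 0 w ≤ klSrcPinnedSumAt … J r n 2 2 0 w′`** for a slot-`0` source pin `w = ((o, (0, a, σ)), 1)` and its twin `w′` in `SrcLabel … J`,
whenever `r ≤ n` (`0 ≤ β`): the END datum of skeleton v9 is dominated by the family-decoupled datum skeleton v10's producer stub supplies.
[cite: BenfattoGiulianiMastropietro2006, §2.9 (4.3)-(4.6)] -/
theorem klSrcPinnedSum_two_two_le_klSrcPinnedSumAt {β : ℝ} (hβ : 0 ≤ β) (U μ : ℝ) (K : TrigPolyC4v) {r n : ℕ} (hr : r ≤ n) (J : ℕ)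
    (o : SpaceTimeIdx L M) (a σ : Fin 2) :
    klSrcPinnedSum L M β U μ K n 2 2 0 ((o, ((⟨0, sectorCount_pos n⟩, a), σ)), 1) ≤
      klSrcPinnedSumAt L M β U μ K J r n 2 2 0 ((o, ((⟨0, sectorCount_pos J⟩, a), σ)), 1) := by
  classical
  have hε : 0 ≤ imagTimeWeight β M := imagTimeWeight_nonneg hβ M
  have h21 : imagTimeWeight β M ^ (2 - 1) = imagTimeWeight β M := by norm_num
  rw [klSrcPinnedSum, klSrcPinnedSumAt_def, h21]
  refine mul_le_mul_of_nonneg_left ?_ hε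
  -- names
  set wn : SrcLabel L M n := ((o, ((⟨0, sectorCount_pos n⟩, a), σ)), 1) with hwn
  set wJ : SrcLabel L M J := ((o, ((⟨0, sectorCount_pos J⟩, a), σ)), 1) with hwJ
  let gn : (Fin 2 → SrcLabel L M n) → ℝ := fun X =>
    klScaleWt L M β n ((univ.image X).image (srcLegPos L M (2 * (2 * M)))) * ‖kernel ℂ (klSrcAction L M β U μ K n) 2 X‖
  let gJ : (Fin 2 → SrcLabel L M J) → ℝ := fun X =>
    klScaleWt L M β r ((univ.image X).image (srcLegPos L M (2 * (2 * M)))) * ‖kernel ℂ (klSrcActionAt L M β U μ K J n) 2 X‖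
  let ψ : (Fin 2 → SrcLabel L M n) → (Fin 2 → SrcLabel L M J) := fun X i =>
    ((((X i).1.1, ((⟨0, sectorCount_pos J⟩, (X i).1.2.1.2), (X i).1.2.2)), (X i).2) : SrcLabel L M J)
  let Fn : Finset (Fin 2 → SrcLabel L M n) :=
    univ.filter (fun X => X 0 = wn ∧ srcCount (fun Y : SrcLabel L M n => Y.2 = 1) X = 2)
  let FJ : Finset (Fin 2 → SrcLabel L M J) :=
    univ.filter (fun X => X 0 = wJ ∧ srcCount (fun Y : SrcLabel L M J => Y.2 = 1) X = 2)
  let S0 : (Fin 2 → SrcLabel L M n) → Prop := fun X => ((X 1).1.2.1.1 : ℕ) = 0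
  show ∑ X ∈ Fn, gn X ≤ ∑ X ∈ FJ, gJ X
  have hgn0 : ∀ X, 0 ≤ gn X := fun X => mul_nonneg (zero_le_one.trans (one_le_klScaleWt L M β n _)) (norm_nonneg _)
  have hgJ0 : ∀ X, 0 ≤ gJ X := fun X => mul_nonneg (zero_le_one.trans (one_le_klScaleWt L M β r _)) (norm_nonneg _)
  -- (1) strings with a DEAD second leg contribute nothing
  have hdead : ∑ X ∈ Fn.filter (fun X => ¬ S0 X), gn X = 0 := by
    refine sum_eq_zero fun X hX => ?_
    simp only [Fn, mem_filter, mem_univ, true_and] at hX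
    have h1 : (X 1).2 = 1 := copy_eq_one_of_srcCount_two X hX.1.2 1
    show klScaleWt L M β n _ * ‖kernel ℂ (klSrcAction L M β U μ K n) 2 X‖ = 0
    rw [kernel_klSrcAction_eq_zero_of_dead β U μ K n 2 X (i := 1) h1 hX.2, norm_zero, mul_zero]
  have hsplit : ∑ X ∈ Fn, gn X = ∑ X ∈ Fn.filter S0, gn X := by
    rw [← sum_filter_add_sum_filter_not Fn S0, hdead, add_zero]
  -- (2) on slot-`0` strings the relabelling is injective, keeps positions and kernels, and the weight only grows (`Λ_n ≤ Λ_r`)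
  have hslot : ∀ X ∈ Fn.filter S0, ∀ i, (X i).2 = 1 ∧ ((X i).1.2.1.1 : ℕ) = 0 := by
    intro X hX i
    simp only [Fn, mem_filter, mem_univ, true_and] at hX
    refine ⟨copy_eq_one_of_srcCount_two X hX.1.2 i, ?_⟩
    fin_cases i
    · show ((X 0).1.2.1.1 : ℕ) = 0
      rw [hX.1.1]
    · exact hX.2
  have hψinj : ∀ X ∈ Fn.filter S0, ∀ X' ∈ Fn.filter S0, ψ X = ψ X' → X = X' := by
    intro X hX X' hX' h
    funext i
    have hi := congrFun h i
    simp only [ψ, Prod.mk.injEq] at hi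
    obtain ⟨⟨hx, ⟨-, hk2⟩, hσ⟩, hc⟩ := hi
    have hk1 : ((X i).1.2.1.1 : ℕ) = ((X' i).1.2.1.1 : ℕ) := by rw [(hslot X hX i).2, (hslot X' hX' i).2]
    refine Prod.ext (Prod.ext hx (Prod.ext (Prod.ext (Fin.ext hk1) hk2) hσ)) hc
  have himg : ∀ X : Fin 2 → SrcLabel L M n,
      (univ.image (ψ X)).image (srcLegPos L M (2 * (2 * M))) = (univ.image X).image (srcLegPos L M (2 * (2 * M))) := by
    intro X
    rw [image_image, image_image]
    rfl
  have hker : ∀ X ∈ Fn.filter S0, kernel ℂ (klSrcActionAt L M β U μ K J n) 2 (ψ X) = kernel ℂ (klSrcAction L M β U μ K n) 2 X := by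
    intro X hX
    rw [kernel_klSrcActionAt_src β U μ K J n 2 (ψ X) (fun i => (hslot X hX i).1) (fun i => rfl),
      kernel_klSrcAction_src β U μ K n 2 X (fun i => (hslot X hX i).1) (fun i => (hslot X hX i).2)]
  have hterm : ∀ X ∈ Fn.filter S0, gn X ≤ gJ (ψ X) := by
    intro X hX
    show klScaleWt L M β n _ * ‖kernel ℂ (klSrcAction L M β U μ K n) 2 X‖ ≤
      klScaleWt L M β r _ * ‖kernel ℂ (klSrcActionAt L M β U μ K J n) 2 (ψ X)‖
    rw [hker X hX, himg X]
    refine mul_le_mul_of_nonneg_right ?_ (norm_nonneg _)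
    rw [klScaleWt_apply, klScaleWt_apply]
    exact add_le_add le_rfl (mul_le_mul_of_nonneg_right (klld_klScale_anti hr) (BattleFederbush.labelDiam_nonneg _ _))
  have hmem : ∀ X ∈ Fn.filter S0, ψ X ∈ FJ := by
    intro X hX
    have hX' := hX
    simp only [Fn, mem_filter, mem_univ, true_and] at hX'
    refine mem_filter.2 ⟨mem_univ _, ?_, ?_⟩
    · show ψ X 0 = wJ
      simp only [ψ, hX'.1.1, hwn, hwJ]
    · rw [srcCount, filter_true_of_mem fun j _ => (hslot X hX j).1, card_univ, Fintype.card_fin]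
  calc ∑ X ∈ Fn, gn X = ∑ X ∈ Fn.filter S0, gn X := hsplit
    _ ≤ ∑ X ∈ Fn.filter S0, gJ (ψ X) := sum_le_sum hterm
    _ = ∑ X ∈ (Fn.filter S0).image ψ, gJ X := (sum_image hψinj).symm
    _ ≤ ∑ X ∈ FJ, gJ X := sum_le_sum_of_subset_of_nonneg (fun X hX => by
        obtain ⟨Y, hY, rfl⟩ := mem_image.1 hX; exact hmem Y hY) fun X _ _ => hgJ0 X

/-- **Token #24 in the v10 currency pays the v9 END datum**: under `SourceProfilesAtLev L M (klSrcBudget P Q U A j) β U μ K J r n` with `r ≤ n`, every v9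
two-source degree-`2` pinned sum at a slot-`0` source pin is `≤ A j 2`. [cite: BenfattoGiulianiMastropietro2006, §2.9 (4.3)-(4.6)] -/
theorem klSrcPinnedSum_two_two_le_of_sourceProfilesAtLev {P : SplitConsts} {Q : EngConsts} {U : ℝ} {A : ℕ → ℕ → ℝ} {β μ : ℝ} (hβ : 0 ≤ β)
    {K : TrigPolyC4v} {J r n j : ℕ} (hr : r ≤ n) (h : SourceProfilesAtLev L M (klSrcBudget P Q U A j) β U μ K J r n)
    (o : SpaceTimeIdx L M) (a σ : Fin 2) :
    klSrcPinnedSum L M β U μ K n 2 2 0 ((o, ((⟨0, sectorCount_pos n⟩, a), σ)), 1) ≤ A j 2 := by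
  refine (klSrcPinnedSum_two_two_le_klSrcPinnedSumAt hβ U μ K hr J o a σ).trans ?_
  have h2 := h 2 (by norm_num) le_rfl 2 0 ((o, ((⟨0, sectorCount_pos J⟩, a), σ)), 1)
  rwa [klSrcBudget_of_le_two P Q U A j 2 le_rfl] at h2

end Compare

end Summit.HubbardSuperconductivity.HubbardSuperconductivity.Theorems.TwoVolumeSource

end
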